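import Summits.FinalStateConjecture.FinalStateConjecture.Theorems.EIHFluxBalanceEIHFluxEvaluationKSKerr
import Summits.FinalStateConjecture.FinalStateConjecture.Theorems.EIHFluxBalanceInertialRecessionStubChargeModelKSEnergy
import Summits.FinalStateConjecture.FinalStateConjecture.Theorems.EIHFluxBalanceInertialRecessionStubChargeModelKSMomentum
import Summits.FinalStateConjecture.FinalStateConjecture.Theorems.EIHFluxBalanceInertialRecessionPerforatedGauss

/-!
# Route EIHFluxBalance — `EIHFluxEvaluation` (b): the Landau–Lifshitz four-momentum of a
# Schwarzschild black hole is `(M, 0, 0, 0)` on EVERY coordinate sphere enclosing it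

Helper file (`--supports stmt-FinalStateConjecture-10188`). For the Schwarzschild metric in ingoing
Kerr–Schild Cartesian coordinates (`Kerr.bilin M 0`) and the Landau–Lifshitz quasi-local
four-momentum `P^μ(t; ξ, R) = ∮_{|y−ξ|=R} Σ_j h^{μ0j} n_j dσ` (LL (96.16),
`LandauLifshitz.quasiLocalMomentum`), the tree already has the values on the spheres CENTRED at the
hole (`KSCharge.quasiLocalMomentum_schwarzschild_energy`: `P^0(t; 0, R) = M`;
`KSCharge.quasiLocalMomentum_schwarzschild_momentum`: `P^i(t; 0, R) = 0`, files
`…StubChargeModelKSEnergy/KSMomentum`). This file moves the sphere: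

* `quasiLocalMomentum_schwarzschild` — **`P^μ(t; ξ, R) = M δ^μ_0` for EVERY coordinate sphere
  enclosing the hole** (`|ξ| < R`): the vacuum shell Gauss law (`LLGauss.shellGaussLaw`) with
  `t_LL(g_{M,0}) ≡ 0` (`pseudotensor_kerr_eq_zero` at `a = 0`, unconditional) moves the sphere to
  a small centred one;
* `quasiLocalMomentum_schwarzschild_of_lt_norm` — **`P^μ(t; ξ, R) = 0` for every sphere NOT
  enclosing the hole** (`0 < R < |ξ|`): the Gauss law on the ball with the complex
  `Σ_α ∂_α h^{μ0α}(g_{M,0}) ≡ 0` (`emComplex_kerr_eq_zero`).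

This is the exact ("`+ 0`") form, for a hole at rest, of clause (b) of the informal item
(`P_i = M_i γ_i v_i + …`, sphere-independent), and the value `E = M` of Virbhadra, Phys. Rev. D 41
(1990) 1086 (Kerr–Schild Cartesian coordinates, `a = Q = 0`).
-/

noncomputable section

open Filter Set
open scoped Matrix Topology ContDiff

namespace Summit.FinalStateConjecture.FinalStateConjecture.Theorems

namespace KSFlux

open Literature.Geometry.Lorentzian Literature.Geometry.Lorentzian.LandauLifshitz
set_option maxSynthPendingDepth 3

open MeasureTheory MeasureTheory.Measure

section Centre

/-- The centred four-momentum as a vector: `P^μ(t; 0, R) = M δ^μ_0` (`R > 0`), assembled from the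
tree's `KSCharge.quasiLocalMomentum_schwarzschild_energy` / `…_momentum`.
[cite: LandauLifshitz1975, §96 (96.16)] -/
theorem quasiLocalMomentum_schwarzschild_centre (M t : ℝ) {R : ℝ} (hR : 0 < R) (μ : Fin 4) :
    quasiLocalMomentum (Kerr.bilin M 0) t 0 R μ = if μ = 0 then M else 0 := by
  refine Fin.cases ?_ (fun i ↦ ?_) μ
  · rw [if_pos rfl]
    exact KSCharge.quasiLocalMomentum_schwarzschild_energy M t hR
  · rw [if_neg (Fin.succ_ne_zero i)]
    exact KSCharge.quasiLocalMomentum_schwarzschild_momentum M t R i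

end Centre

/-! ### Every sphere enclosing the hole -/

section Enclosing

/-- **The Landau–Lifshitz four-momentum of a Schwarzschild black hole is `(M, 0, 0, 0)` on every
coordinate sphere enclosing it**: `P^μ(t; ξ, R) = M δ^μ_0` whenever `|ξ| < R`, for every real
`M` and every `t` — sphere-independence by the vacuum shell Gauss law with `t_LL ≡ 0`, then the
centred value. [cite: LandauLifshitz1975, §96 (96.16)–(96.17)] -/
theorem quasiLocalMomentum_schwarzschild (M t : ℝ) {ξ : E3} {R : ℝ} (hξ : ‖ξ‖ < R) (μ : Fin 4) :
    quasiLocalMomentum (Kerr.bilin M 0) t ξ R μ = if μ = 0 then M else 0 := by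
  -- a small centred sphere inside
  set ρ : ℝ := (R - ‖ξ‖) / 2 with hρ
  have hρ0 : 0 < ρ := by rw [hρ]; linarith
  have hsub : Metric.closedBall (0 : E3) ρ ⊆ Metric.ball ξ R := fun y hy ↦ by
    rw [Metric.mem_closedBall, dist_zero_right] at hy
    rw [Metric.mem_ball, dist_eq_norm]
    linarith [norm_sub_le y ξ]
  -- the shell lies in the vacuum chart domain `Kerr.region 0 0 = {r > 0}`
  have hKU : ∀ y ∈ Metric.closedBall ξ R \ Metric.ball (0 : E3) ρ,
      E4.ofTimeSpace t y ∈ (Kerr.region 0 0 : Set E4) := fun y hy ↦ by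
    have hy' : ρ ≤ ‖y‖ := by
      have h := hy.2
      rwa [Metric.mem_ball, dist_zero_right, not_lt] at h
    change E4.ofTimeSpace t y ∈ Kerr.region 0 0
    rw [Kerr.mem_region, Kerr.radius_zero_left, E4.spatialNorm_ofTimeSpace, max_self]
    linarith
  have hg : ContDiffOn ℝ ∞ (Kerr.bilin M 0) (Kerr.region 0 0 : Set E4) := fun x hx ↦
    (Kerr.contDiffAt_bilin M 0 (Kerr.radius_pos_of_mem_region hx)).contDiffWithinAt
  have hdet : ∀ x ∈ (Kerr.region 0 0 : Set E4), metricDet (Kerr.bilin M 0) x < 0 := fun x hx ↦ by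
    obtain ⟨φ, ℓ, n, hn, hℓ, hK⟩ := kerr_nullRankOne 0 (Kerr.radius_pos_of_mem_region hx)
    rw [kerr_bilin_eq_ksFamily M 0,
      metricDet_ksFamily (K := fun z ↦ Kerr.bilin 1 0 z - Minkowski.bilin) hn hℓ hK M]
    norm_num
  have hric : ∀ x ∈ (Kerr.region 0 0 : Set E4), MetricCoord.ricAt (Kerr.bilin M 0) x = 0 :=
    fun x hx ↦ ricAt_kerr_eq_zero M 0 0 hx
  have h := LLGauss.shellGaussLaw (Kerr.region 0 0).isOpen hg hdet hric hρ0 hsub hKU μ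
  rw [setIntegral_eq_zero_of_forall_eq_zero fun y hy ↦ by
    rw [pseudotensor_kerr_eq_zero M 0 0 (hKU y hy), mul_zero], sub_eq_zero] at h
  rw [h, quasiLocalMomentum_schwarzschild_centre M t hρ0]

/-- **The energy of a Schwarzschild black hole is its mass** on every enclosing coordinate sphere:
`P^0(t; ξ, R) = M` for `|ξ| < R`. [cite: LandauLifshitz1975, §96 (96.16)] -/
theorem quasiLocalEnergy_schwarzschild (M t : ℝ) {ξ : E3} {R : ℝ} (hξ : ‖ξ‖ < R) :
    quasiLocalMomentum (Kerr.bilin M 0) t ξ R 0 = M := by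
  rw [quasiLocalMomentum_schwarzschild M t hξ, if_pos rfl]

/-- **A Schwarzschild black hole at rest has zero linear momentum** on every enclosing coordinate
sphere: `P^i(t; ξ, R) = 0` for `|ξ| < R`. [cite: LandauLifshitz1975, §96 (96.16)] -/
theorem quasiLocalMomentum_schwarzschild_space (M t : ℝ) {ξ : E3} {R : ℝ} (hξ : ‖ξ‖ < R) (i : Fin
    3) :
    quasiLocalMomentum (Kerr.bilin M 0) t ξ R i.succ = 0 := by
  rw [quasiLocalMomentum_schwarzschild M t hξ, if_neg (Fin.succ_ne_zero i)]

end Enclosing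

/-! ### Spheres not enclosing the hole -/

section Outside

/-- **A coordinate sphere that does not enclose the hole carries no Landau–Lifshitz four-momentum**:
`P^μ(t; ξ, R) = 0` whenever `0 < R < |ξ|` — the Gauss law on the (unperforated) ball with the
complex `Σ_α ∂_α h^{μ0α}(g_{M,0}) ≡ 0` off the time axis. [cite: LandauLifshitz1975, §96 (96.17)] -/
theorem quasiLocalMomentum_schwarzschild_of_lt_norm (M t : ℝ) {ξ : E3} {R : ℝ} (hR : 0 < R)
    (hξ : R < ‖ξ‖) (μ : Fin 4) : quasiLocalMomentum (Kerr.bilin M 0) t ξ R μ = 0 := by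
  have hKW : ∀ y : E3, dist y ξ ≤ R → (∀ j : Fin 0, (Fin.elim0 j : ℝ) ≤ dist y (Fin.elim0 j)) →
      E4.ofTimeSpace t y ∈ (Kerr.region 0 0 : Set E4) := fun y hy _ ↦ by
    change E4.ofTimeSpace t y ∈ Kerr.region 0 0
    rw [Kerr.mem_region, Kerr.radius_zero_left, E4.spatialNorm_ofTimeSpace, max_self]
    rw [dist_eq_norm] at hy
    linarith [norm_sub_norm_le ξ y, norm_sub_rev ξ y]
  have hg : ContDiffOn ℝ ∞ (Kerr.bilin M 0) (Kerr.region 0 0 : Set E4) := fun x hx ↦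
    (Kerr.contDiffAt_bilin M 0 (Kerr.radius_pos_of_mem_region hx)).contDiffWithinAt
  have hdet : ∀ x ∈ (Kerr.region 0 0 : Set E4), metricDet (Kerr.bilin M 0) x ≠ 0 := fun x hx ↦ by
    obtain ⟨φ, ℓ, n, hn, hℓ, hK⟩ := kerr_nullRankOne 0 (Kerr.radius_pos_of_mem_region hx)
    rw [kerr_bilin_eq_ksFamily M 0,
      metricDet_ksFamily (K := fun z ↦ Kerr.bilin 1 0 z - Minkowski.bilin) hn hℓ hK M]
    norm_num
  have h := LLGauss.perforatedGauss (Kerr.region 0 0).isOpen hg hdet (t := t) (c := ξ)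
    (ξ := Fin.elim0) (ρ := Fin.elim0) hR (fun j ↦ Fin.elim0 j) (fun j ↦ Fin.elim0 j)
    (fun j ↦ Fin.elim0 j) hKW μ
  rw [Finset.univ_eq_empty, Finset.sum_empty, sub_zero] at h
  rw [h]
  refine setIntegral_eq_zero_of_forall_eq_zero fun y hy ↦ ?_
  exact emComplex_kerr_eq_zero M 0 0 (hKW y hy.1 hy.2) μ 0

end Outside


end KSFlux

end Summit.FinalStateConjecture.FinalStateConjecture.Theorems

end
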